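import Summits.Ventures.WeilGRH.BaseRungOddTransfer
import Mathlib.Analysis.Complex.Exponential
import HarnessLib

/-!
# Prime-free windows for the two small conductors `q = 3, 4`: `WeilPositivityOnChar χ (1/4)` mod 3,
# `WeilPositivityOnChar χ (1/3)` mod 4 (both parities), and the general-window EVEN transfer

Cell `rh-explicit`, GRH arm (lead ruling R7-8 (3): lemmas of the withdrawn `TransferFromZeta.lean`
absent from the landed transfer files ride in one small file).  The base rung `t = (log 2)/2` holds by
transfer for every character mod `q ≥ 5` (`weilPositivityOnChar_log_two_half`,
`BaseRungOddTransfer.lean`; even part `BaseRungEvenTransfer.lean`, weil-grh-2); for `q = 3, 4` the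
transfer inequality `2(sinh a + a) ≤ log q` fails at `a = (log 2)/2` (`1/√2 + log 2 = 1.4003 > log 4`)
but holds on a shorter window.  Here:
* `weilPositivityOnChar_of_even` — the EVEN analogue of `weilPositivityOnChar_of_odd` on a general
  prime-free window (`q ≠ 1`, `2a ≤ log 2`, `2(sinh a + a) ≤ log q`), and the parity-free
  `weilPositivityOnChar_transfer`;
* numerics `2(sinh ¼ + ¼) ≤ 1.007`, `2(sinh ⅓ + ⅓) ≤ 1.349` (Taylor bounds `Real.exp_bound`),
  `log 3 > 1.089` (`2^11 < 3^7`), `log 4 = 2 log 2 > 1.386` (inline; cf. the tree's `real_log_four_gt`);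
* `weilPositivityOnChar_quarter_of_mod_three : WeilPositivityOnChar χ (1/4)` for every `χ` mod 3 and
  `weilPositivityOnChar_third_of_mod_four : WeilPositivityOnChar χ (1/3)` for every `χ` mod 4.
No named fact; axioms standard.
-/

noncomputable section

open Complex Filter Set MeasureTheory
open scoped Real Topology ComplexConjugate

namespace Summit.Ventures.WeilGRH

open Literature.NumberTheory.LFunctions

variable {q : ℕ} {g : ℝ → ℂ}

/-- On the prime-free window and for an EVEN character mod `q ≠ 1`:
`Re Q_χ(g) = E(g) − 2 Re(ĝ(0) conj ĝ(1)) + (log q)‖g‖₂²` (no parity term). [folklore] -/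
theorem re_weilQuadraticChar_of_even (hq : q ≠ 1) {χ : DirichletCharacter ℂ q} (hχ : χ.Even)
    (hg : IsWeilTest g) {a : ℝ} (hsupp : tsupport g ⊆ Icc (-a) a) (ha : 2 * a ≤ Real.log 2) :
    (weilQuadraticChar χ g).re =
      weilArchQuadratic g - 2 * (weilMellin g 0 * conj (weilMellin g 1)).re +
        Real.log q * ∫ t : ℝ, ‖g t‖ ^ 2 := by
  rw [weilQuadraticChar_eq_arch_of_tsupport_subset hq hg hsupp ha, charParity_of_even hχ,
    weilArchTermChar, weilArchIntegralChar_zero, weilArchIntegral_weilConv_weilReflect hg,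
    weilConv_weilReflect_apply_zero, weilArchQuadratic]
  have hπ : ((1 / (2 * π) : ℂ)) = ((1 / (2 * π) : ℝ) : ℂ) := by push_cast; ring
  rw [hπ]
  simp only [← Complex.ofReal_mul, ← Complex.ofReal_add, Complex.ofReal_re, Complex.mul_re]
  ring

/-- **TRANSFER, even characters, general prime-free window**: `q ≠ 1`, `χ.Even`, `2a ≤ log 2`,
`2(sinh a + a) ≤ log q` ⟹ `WeilPositivityOnChar χ a` (Yoshida's theorem `E(g) ≥ 0` in the tree +
`weilPolar_re_le`). [folklore] -/
theorem weilPositivityOnChar_of_even (hq : q ≠ 1) {χ : DirichletCharacter ℂ q} (hχ : χ.Even)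
    {a : ℝ} (ha : 2 * a ≤ Real.log 2) (hqa : 2 * (Real.sinh a + a) ≤ Real.log q) :
    WeilPositivityOnChar χ a := by
  intro g hg hsupp
  have hsupp' : tsupport g ⊆ Icc (-(Real.log 2 / 2)) (Real.log 2 / 2) :=
    hsupp.trans (Icc_subset_Icc (by linarith) (by linarith))
  have hE : 0 ≤ weilArchQuadratic g :=
    weilPositivityOn_log_two_half_iff.1 weilPositivityOn_log_two_half_holds g hg hsupp'
  have hP := weilPolar_re_le hg hsupp
  have hN : 0 ≤ ∫ t : ℝ, ‖g t‖ ^ 2 := integral_nonneg fun t ↦ by positivity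
  rw [re_weilQuadraticChar_of_even hq hχ hg hsupp ha]
  nlinarith [mul_le_mul_of_nonneg_right hqa hN]

/-- **TRANSFER, any parity, general prime-free window.** [folklore] -/
theorem weilPositivityOnChar_transfer (hq : q ≠ 1) [NeZero q] (χ : DirichletCharacter ℂ q)
    {a : ℝ} (ha : 2 * a ≤ Real.log 2) (hqa : 2 * (Real.sinh a + a) ≤ Real.log q) :
    WeilPositivityOnChar χ a := by
  rcases χ.even_or_odd with h | h
  · exact weilPositivityOnChar_of_even hq h ha hqa
  · exact weilPositivityOnChar_of_odd hq h ha hqa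

/-! ## Numerics for `q = 3, 4` -/

/-- `sinh x ≤ x + (7/36) x³ + (5/192) x⁴` for `0 ≤ x ≤ 1` (Taylor bounds of order 4 for `eˣ` and
order 3 for `e^{-x}`, `Real.exp_bound`). [folklore] -/
theorem sinh_le_taylor {x : ℝ} (h0 : 0 ≤ x) (h1 : x ≤ 1) :
    Real.sinh x ≤ x + 7 / 36 * x ^ 3 + 5 / 192 * x ^ 4 := by
  have hup : Real.exp x ≤ 1 + x + x ^ 2 / 2 + x ^ 3 / 6 + x ^ 4 * 5 / 96 := by
    have h := Real.exp_bound' h0 h1 (n := 4) (by norm_num)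
    have hs : (∑ m ∈ Finset.range 4, x ^ m / m.factorial) = 1 + x + x ^ 2 / 2 + x ^ 3 / 6 := by
      simp [Finset.sum_range_succ, Nat.factorial]
    rw [hs] at h
    norm_num [Nat.factorial] at h
    linarith
  have hlo : 1 - x + x ^ 2 / 2 - x ^ 3 * 2 / 9 ≤ Real.exp (-x) := by
    have habs : |(-x)| ≤ 1 := by rw [abs_neg, abs_of_nonneg h0]; exact h1
    have h := Real.exp_bound habs (n := 3) (by norm_num)
    have hs : (∑ m ∈ Finset.range 3, (-x) ^ m / m.factorial) = 1 - x + x ^ 2 / 2 := by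
      simp [Finset.sum_range_succ, Nat.factorial]
      ring
    rw [hs, abs_neg, abs_of_nonneg h0] at h
    norm_num [Nat.factorial] at h
    have := (abs_sub_le_iff.1 h).2
    linarith
  rw [Real.sinh_eq]
  linarith

/-- `2(sinh(1/4) + 1/4) ≤ 1.007`. [folklore] -/
theorem two_mul_sinh_quarter_add_le : 2 * (Real.sinh (1 / 4) + 1 / 4) ≤ 1.007 := by
  have h := sinh_le_taylor (x := 1 / 4) (by norm_num) (by norm_num)
  nlinarith

/-- `2(sinh(1/3) + 1/3) ≤ 1.349`. [folklore] -/
theorem two_mul_sinh_third_add_le : 2 * (Real.sinh (1 / 3) + 1 / 3) ≤ 1.349 := by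
  have h := sinh_le_taylor (x := 1 / 3) (by norm_num) (by norm_num)
  nlinarith

/-- `log 3 > 1.089` (`3^7 > 2^11` and `log 2 > 0.6931471803`). [folklore] -/
theorem log_three_gt : (1.089 : ℝ) < Real.log 3 := by
  have h : Real.log ((2 : ℝ) ^ 11) < Real.log ((3 : ℝ) ^ 7) :=
    Real.log_lt_log (by positivity) (by norm_num)
  rw [Real.log_pow, Real.log_pow] at h
  have h2 := Real.log_two_gt_d9
  push_cast at h
  nlinarith

/-! ## The two small conductors -/

/-- **Every Dirichlet character mod 3 satisfies `WeilPositivityOnChar χ (1/4)`** (window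
`[-1/4, 1/4]`, prime-free; `2(sinh ¼ + ¼) ≤ 1.007 < 1.089 < log 3`). [folklore] -/
theorem weilPositivityOnChar_quarter_of_mod_three (χ : DirichletCharacter ℂ 3) :
    WeilPositivityOnChar χ (1 / 4) := by
  refine weilPositivityOnChar_transfer (by norm_num) χ ?_ ?_
  · have := Real.log_two_gt_d9; linarith
  · have h1 := two_mul_sinh_quarter_add_le
    have h2 := log_three_gt
    have h3 : Real.log ((3 : ℕ) : ℝ) = Real.log 3 := by norm_num
    rw [h3]
    linarith

/-- **Every Dirichlet character mod 4 satisfies `WeilPositivityOnChar χ (1/3)`** (window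
`[-1/3, 1/3]`, prime-free; `2(sinh ⅓ + ⅓) ≤ 1.349 < 1.386 < log 4`). [folklore] -/
theorem weilPositivityOnChar_third_of_mod_four (χ : DirichletCharacter ℂ 4) :
    WeilPositivityOnChar χ (1 / 3) := by
  refine weilPositivityOnChar_transfer (by norm_num) χ ?_ ?_
  · have := Real.log_two_gt_d9; linarith
  · have h1 := two_mul_sinh_third_add_le
    -- `log 4 = 2 log 2 > 1.386` (also in the tree as `real_log_four_gt`, BookerLemmaBoundary.lean)
    have h2 : (1.386 : ℝ) < Real.log (4 : ℕ) := by
      have h : Real.log ((4 : ℕ) : ℝ) = 2 * Real.log 2 := by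
        rw [show ((4 : ℕ) : ℝ) = 2 ^ 2 by norm_num, Real.log_pow]; push_cast; ring
      rw [h]
      have := Real.log_two_gt_d9
      linarith
    linarith

end Summit.Ventures.WeilGRH

end
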